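/-
Copyright: cell `pub-balaban-gaps` (G2), seat ne6 (row NE7b), `prover-pub-balaban-gaps-ne6-g12-0`. Released under the licence of the
surrounding project.
-/
import Mathlib.Data.Real.Basic
import Mathlib.Algebra.Order.Chebyshev
import Mathlib.Tactic

/-!
# NESTED WINDOWS: threshold nesting `θ < 1` + a bond-Lipschitz plaquette observable ⟹ (i) the older characteristic functions are `≡ 1`
# on the centred window, (ii) the NEW large-field event does not meet the window and sits at squared bond-distance `≥ ((1−θ)τ)²∕n`
# from the centre, (iii) with a displayed convexity floor the relative large-field FLOOR letter is `a = (λ∕2)·((1−θ)τ)²∕n`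
# (row NE7b, node U5c; the refuter's ϝ-ne7bref-g70-1 display and the SHAPE of [Balaban1989LargeFieldI] (1.24)∕(1.27)∕(1.29), as arithmetic)

Cell `pub-balaban-gaps` (G2 spine census) for the `pub-balaban` T⁴ crux NE7b (`T4WeightBudget.RelWeightBound`; the cell's OWN estimate —
NOT PRINTED in [Bałaban 1983–89], NOT PROVED).  Crux-route work under `Spine/NE7b/`; NOTHING of Bałaban's is named or asserted; no
`T4Continuum/Support` leaf typed; no `def`; zero `sorry`; MATHLIB ONLY (independent of every `BalabanUV` olean).

WHY.  The fibrewise relative carriers of the row (OWNER `CompactFibreCarrier` ∕ `CompactFibreLCS`, leaf-01 `CompactFibreRelative`, this seat's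
`CompactFibreWindowSU2 ∕ SUN ∕ Centred`) consume two pointwise letters in ONE level `m(y)`: `hnum : F x ≠ 0 → w y ≠ 0 → m y ≤ I (x, y)`
(the numerator's LARGE-FIELD support lies above the level) and `hIrel : I (U₀ y · v, y) ≤ m y + i₀` on the window (the denominator's mass near the
centre).  The refuter's located ϝ-ne7bref-g70-1 (PRICING-NE7b v77 F418): with `m := m₀(y)` (the fibre minimum) `hnum` is free and NO large-field
gain is sold; the gain `a` in `m := m₀ + a` — «NE7b's sale» — comes from `a(y) ≥ (λ∕2)·dist(U₀(y), supp F)²` (local uniform convexity, modulus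
`λ`) and `dist ≥ (1 − θ(y))·τ∕4` where `θ(y) :=` how close the CENTRE's own core plaquettes already sit to the large-field threshold `τ`; a
fibrewise-uniform gain therefore NEEDS print's THRESHOLD NESTING `sup_y θ(y) ≤ θ* < 1` (Q-ne7bref-g70-2, a printed-constant lookup).  Print's
own use of the nesting shape: [Balaban1989LargeFieldI] pp. 181–187 — the nested thresholds `c(1 − β(1 − 2^{−n}))ε_j(L^{k−j}η)²` of
(1.24), the fluctuation window `2δ′_j` of (1.27), the printed claim (1.29) «the restrictions introduced by the new characteristic functions imply
that the functions (1.3), (1.4), (1.5), (1.7), (1.8), `χ_k^{(n)}` are equal to 1» and its proof (1.31)∕(1.43)∕(1.48)–(1.52) — is ALREADY TYPED AS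
PRINTED in the tree by the `lit-balaban` cell and is NOT re-typed here: `Balaban1983to89.B15SmallField185.ineq143` ∕ `sf17_of_reps` ((1.43) ⟹
(1.7)), `sf13_of_131`, `sf18_of_reps`, `claim181`; `Balaban1983to89.B15.BasicStep.SF149` ∕ `SF151` ∕ `Ineq148` ∕ `sf149_step`,
`B15Ineq148Proof.sf151_step`, `B15Claim129Step.lines124_step` ∕ `claim129_step_of_chain` ((1.24)'s induction with the printed `α = 1∕8`).
THIS FILE types only the MODEL-level skeleton in the ROW's carrier letters (observable ∕ window ∕ large-field event ∕ floor) whose printed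
instance those theorems are, and the one display the row owes (ϝ): separation + floor.  Contents:

* §1 ONE OBSERVABLE.  Data: the observable's value `w` at a configuration, `w₀` at the centre, bond deviations `d b` on a bond set `s`, and
  the bond-Lipschitz letter `hLip : |w − w₀| ≤ ∑_{b ∈ s} d b` (for `SU(2)` plaquette words in the quaternion model this is
  `CompactFibreWindowCentred.norm_su2Quat_word_sub_word_le`; here it is a HYPOTHESIS).  `obs_le_of_window` (`d ≤ ρ` on `s` ⊢ `w ≤ w₀ + #s·ρ`),
  **`obs_lt_of_nested`** (`w₀ ≤ θτ`, `θτ + #s·ρ < τ′` ⊢ `w < τ′` — the (1.29) shape: an older∕other characteristic function is `1` on the window),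
  **`sum_dev_ge_of_large`** (`τ ≤ w` ⊢ `(1 − θ)τ ≤ ∑ d`), `exists_dev_ge_of_large` (pigeonhole: some bond deviates by `≥ (1 − θ)τ∕#s`),
  **`sq_div_card_le_sum_sq_dev_of_large`** (Cauchy–Schwarz: `((1 − θ)τ)²∕#s ≤ ∑ d²`).
* §2 A CORE OF PLAQUETTES.  Configurations `x : X` (any type), per-bond deviations from the centre `dev x b`, observables `w p x` with centre
  values `w₀ p`, bond sets `bd p`, core `C`; the plain sets WINDOW `{x | ∀ p ∈ C, ∀ b ∈ bd p, dev x b ≤ ρ}`, LARGE-FIELD EVENT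
  `{x | ∃ p ∈ C, τ ≤ w p x}`, SMALL-FIELD SET `{x | ∀ p ∈ C, w p x < τ′}` (nothing abbreviated, nothing defined).
  **`window_subset_smallField`** (nesting ⊢ window ⊆ small-field set), **`disjoint_window_largeField`** (the window does not meet the NEW
  large-field event), **`exists_sq_le_sum_sq_dev_of_largeField`**, `sq_div_le_quadDev_of_largeField` (any quadratic deviation `D2 x`
  dominating each core plaquette's `∑_{b ∈ bd p} (dev x b)²`, bond sets of size `≤ n` ⊢ `((1 − θ)τ)²∕n ≤ D2 x` on the large-field event).
* §3 THE FLOOR LETTER.  **`floor_on_largeField`** (a displayed convexity floor `m₀ + (λ∕2)·D2 x ≤ I x` on a set containing the large-field event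
  ⊢ `m₀ + (λ∕2)·((1 − θ)τ)²∕n ≤ I x` there) and the fibrewise **`hnum_of_nesting`** — VERBATIM the `hnum` hypothesis shape of
  `CompactFibreRelative.relFibre_moment_le` with `m y := m₀ y + (λ∕2)·((1 − θ)τ)²∕n`: the relative floor `a` DISPLAYED from three numbers
  (`θ` the centre's nesting ratio, `τ` the threshold, `λ` the modulus) and one integer (`n`, `= 4` for plaquettes).
* §4 a two-bond toy.

HONEST REMARKS.  MODEL∕arithmetic only: which thresholds, windows and moduli print uses at a creation step, that the centre is the boundary-data
minimiser, that a convexity floor of modulus `λ` holds out to the large-field event, and the value of `θ*` are (A3)∕(A1c) readings and the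
refuter's lookup Q-ne7bref-g70-2 — NOT asserted, NOT valued, NOT discharged here; the printed (1.29) is about Bałaban's configurations
(1.26)∕(1.30) with exponential-decay corrections ((1.31), (1.38)), of which only the triangle-inequality skeleton is typed.  Nothing of Bałaban's
is asserted.  NE7b NOT PRINTED ∕ NOT PROVED; spine PROVED 0∕9; rung (B)+1 on a FINITE torus — NOT infinite volume, NOT the mass gap, NOT Clay.
HONEST DEPENDENCY: continuum YM on T⁴ ⇐ BetaPertH ∧ nine spine estimates (0/9 proved); BetaPertH ⇐ (D1) ∧ (D4) ∧ CAP+tail;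
G-an2-4 gates asym, D1 and NE2/3/4.  This file changes none of it.
-/

set_option autoImplicit false

open Finset

namespace Summit.QuantumFields.BalabanUV.T4Continuum.NE7b.NestedWindows

/-! ## §1 One observable: window bound, nesting, separation -/

section OneObservable

variable {B : Type*} {s : Finset B} {d : B → ℝ} {w w₀ θ τ τ' ρ : ℝ}

/-- The bond-Lipschitz letter moves the observable by at most the total bond deviation: `w ≤ w₀ + ∑ d`. [folklore] -/
theorem obs_le_add_sum_dev (hLip : |w - w₀| ≤ ∑ b ∈ s, d b) : w ≤ w₀ + ∑ b ∈ s, d b := by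
  have h := (abs_sub_le_iff.1 hLip).1
  linarith

/-- And the centre's value is at most the observable plus the total deviation: `w₀ ≤ w + ∑ d`. [folklore] -/
theorem centre_le_add_sum_dev (hLip : |w - w₀| ≤ ∑ b ∈ s, d b) : w₀ ≤ w + ∑ b ∈ s, d b := by
  have h := (abs_sub_le_iff.1 hLip).2
  linarith

/-- WINDOW BOUND: if every bond of the observable deviates by at most `ρ` from the centre, the observable exceeds its centre value by at
most `#s · ρ`. [folklore] -/
theorem obs_le_of_window (hLip : |w - w₀| ≤ ∑ b ∈ s, d b) (hwin : ∀ b ∈ s, d b ≤ ρ) :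
    w ≤ w₀ + s.card * ρ := by
  have hsum : ∑ b ∈ s, d b ≤ ∑ _b ∈ s, ρ := Finset.sum_le_sum hwin
  rw [Finset.sum_const, nsmul_eq_mul] at hsum
  linarith [obs_le_add_sum_dev hLip]

/-- NESTING (the shape of [Balaban1989LargeFieldI] (1.29)∕(1.43); print's instance is typed in the tree as
`B15SmallField185.ineq143` ∕ `sf17_of_reps`): a centre `θ`-deep inside threshold `τ` and a per-bond window `ρ` with `θτ + #s·ρ < τ′` keep the
observable STRICTLY below `τ′` — the characteristic function `χ(w < τ′)` equals `1` on the window. [folklore] -/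
theorem obs_lt_of_nested (hLip : |w - w₀| ≤ ∑ b ∈ s, d b) (hwin : ∀ b ∈ s, d b ≤ ρ) (hcentre : w₀ ≤ θ * τ)
    (hnest : θ * τ + s.card * ρ < τ') : w < τ' := by
  linarith [obs_le_of_window hLip hwin]

/-- The non-strict variant: `θτ + #s·ρ ≤ τ′` ⊢ `w ≤ τ′`. [folklore] -/
theorem obs_le_of_nested (hLip : |w - w₀| ≤ ∑ b ∈ s, d b) (hwin : ∀ b ∈ s, d b ≤ ρ) (hcentre : w₀ ≤ θ * τ)
    (hnest : θ * τ + s.card * ρ ≤ τ') : w ≤ τ' := by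
  linarith [obs_le_of_window hLip hwin]

/-- SEPARATION: a configuration LARGE at this observable (`τ ≤ w`) over a centre `θ`-deep inside the threshold (`w₀ ≤ θτ`) has total bond
deviation `≥ (1 − θ)τ`. [folklore] -/
theorem sum_dev_ge_of_large (hLip : |w - w₀| ≤ ∑ b ∈ s, d b) (hcentre : w₀ ≤ θ * τ) (hlarge : τ ≤ w) :
    (1 - θ) * τ ≤ ∑ b ∈ s, d b := by
  have h := obs_le_add_sum_dev hLip
  nlinarith

/-- Pigeonhole form of the separation: SOME bond of the observable deviates by `≥ (1 − θ)τ ∕ #s`. [folklore] -/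
theorem exists_dev_ge_of_large (hs : s.Nonempty) (hLip : |w - w₀| ≤ ∑ b ∈ s, d b) (hcentre : w₀ ≤ θ * τ)
    (hlarge : τ ≤ w) : ∃ b ∈ s, (1 - θ) * τ / s.card ≤ d b := by
  have hcard : (0 : ℝ) < s.card := by exact_mod_cast hs.card_pos
  refine Finset.exists_le_of_sum_le hs ?_
  rw [Finset.sum_const, nsmul_eq_mul, mul_div_cancel₀ _ hcard.ne']
  exact sum_dev_ge_of_large hLip hcentre hlarge

/-- Cauchy–Schwarz form of the separation (the currency of a quadratic convexity floor): `((1 − θ)τ)² ∕ #s ≤ ∑ d²`, for a nonempty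
bond set and `θτ ≤ τ` (so that `(1 − θ)τ ≥ 0`; no sign condition on the deviations is needed). [folklore] -/
theorem sq_div_card_le_sum_sq_dev_of_large (hs : s.Nonempty) (hLip : |w - w₀| ≤ ∑ b ∈ s, d b)
    (hcentre : w₀ ≤ θ * τ) (hθτ : θ * τ ≤ τ) (hlarge : τ ≤ w) :
    ((1 - θ) * τ) ^ 2 / s.card ≤ ∑ b ∈ s, d b ^ 2 := by
  have hcard : (0 : ℝ) < s.card := by exact_mod_cast hs.card_pos
  have hsep : (1 - θ) * τ ≤ ∑ b ∈ s, d b := sum_dev_ge_of_large hLip hcentre hlarge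
  have h0 : 0 ≤ (1 - θ) * τ := by nlinarith
  have hsq : ((1 - θ) * τ) ^ 2 ≤ (∑ b ∈ s, d b) ^ 2 := pow_le_pow_left₀ h0 hsep 2
  have hcs : (∑ b ∈ s, d b) ^ 2 ≤ s.card * ∑ b ∈ s, d b ^ 2 := sq_sum_le_card_mul_sum_sq
  rw [div_le_iff₀ hcard]
  nlinarith [Finset.sum_nonneg (fun b hb => sq_nonneg (d b)) (s := s)]

end OneObservable

/-! ## §2 A core of plaquettes: the window, the large-field event, the small-field set -/

section Core

variable {X P B : Type*} {C : Finset P} {bd : P → Finset B} {w : P → X → ℝ} {w₀ : P → ℝ} {dev : X → B → ℝ}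
  {θ τ τ' ρ : ℝ} {n : ℕ}

/-- NESTING ⟹ THE OLDER CHARACTERISTIC FUNCTIONS ARE `1` ON THE WINDOW ((1.29) shape): if every core observable is bond-Lipschitz, the
centre is `θ`-deep inside `τ` on the core, bond sets have `≤ n` bonds, `0 ≤ ρ` and `θτ + n·ρ < τ′`, then the centred per-bond window of
radius `ρ` lies inside the small-field set of threshold `τ′`. [folklore] -/
theorem window_subset_smallField
    (hLip : ∀ p ∈ C, ∀ x, |w p x - w₀ p| ≤ ∑ b ∈ bd p, dev x b)
    (hcentre : ∀ p ∈ C, w₀ p ≤ θ * τ) (hcard : ∀ p ∈ C, (bd p).card ≤ n) (hρ : 0 ≤ ρ)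
    (hnest : θ * τ + n * ρ < τ') :
    {x : X | ∀ p ∈ C, ∀ b ∈ bd p, dev x b ≤ ρ} ⊆ {x : X | ∀ p ∈ C, w p x < τ'} := by
  intro x hx p hp
  have hn : ((bd p).card : ℝ) * ρ ≤ n * ρ := by
    have : ((bd p).card : ℝ) ≤ n := by exact_mod_cast hcard p hp
    exact mul_le_mul_of_nonneg_right this hρ
  exact obs_lt_of_nested (hLip p hp x) (hx p hp) (hcentre p hp) (by linarith)

/-- THE WINDOW DOES NOT MEET THE NEW LARGE-FIELD EVENT: under the same nesting with `τ′ = τ`, no configuration of the window is large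
(`τ ≤ w p x`) at any core plaquette. [folklore] -/
theorem disjoint_window_largeField
    (hLip : ∀ p ∈ C, ∀ x, |w p x - w₀ p| ≤ ∑ b ∈ bd p, dev x b)
    (hcentre : ∀ p ∈ C, w₀ p ≤ θ * τ) (hcard : ∀ p ∈ C, (bd p).card ≤ n) (hρ : 0 ≤ ρ)
    (hnest : θ * τ + n * ρ < τ) :
    Disjoint {x : X | ∀ p ∈ C, ∀ b ∈ bd p, dev x b ≤ ρ} {x : X | ∃ p ∈ C, τ ≤ w p x} := by
  rw [Set.disjoint_left]
  intro x hx hlarge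
  obtain ⟨p, hp, hτ⟩ := hlarge
  have hlt : w p x < τ := window_subset_smallField hLip hcentre hcard hρ hnest hx p hp
  linarith

/-- SEPARATION ON THE LARGE-FIELD EVENT (Cauchy–Schwarz currency): a configuration large at some core plaquette over a `θ`-nested centre
has, at that plaquette, `((1 − θ)τ)² ∕ #(bd p) ≤ ∑_{b ∈ bd p} (dev x b)²`. [folklore] -/
theorem exists_sq_le_sum_sq_dev_of_largeField
    (hLip : ∀ p ∈ C, ∀ x, |w p x - w₀ p| ≤ ∑ b ∈ bd p, dev x b)
    (hcentre : ∀ p ∈ C, w₀ p ≤ θ * τ) (hθτ : θ * τ ≤ τ) (hne : ∀ p ∈ C, (bd p).Nonempty)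
    {x : X} (hx : x ∈ {x : X | ∃ p ∈ C, τ ≤ w p x}) :
    ∃ p ∈ C, ((1 - θ) * τ) ^ 2 / (bd p).card ≤ ∑ b ∈ bd p, dev x b ^ 2 := by
  obtain ⟨p, hp, hτ⟩ := hx
  exact ⟨p, hp, sq_div_card_le_sum_sq_dev_of_large (hne p hp) (hLip p hp x) (hcentre p hp) hθτ hτ⟩

/-- The same in a GLOBAL quadratic deviation `D2` (e.g. the sum of squared deviations over all bonds of the region): if `D2 x` dominates each
core plaquette's `∑_{b ∈ bd p} (dev x b)²` and bond sets have at most `n` bonds, then `((1 − θ)τ)² ∕ n ≤ D2 x` on the large-field event. [folklore] -/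
theorem sq_div_le_quadDev_of_largeField {D2 : X → ℝ}
    (hLip : ∀ p ∈ C, ∀ x, |w p x - w₀ p| ≤ ∑ b ∈ bd p, dev x b)
    (hcentre : ∀ p ∈ C, w₀ p ≤ θ * τ) (hθτ : θ * τ ≤ τ) (hne : ∀ p ∈ C, (bd p).Nonempty)
    (hcard : ∀ p ∈ C, (bd p).card ≤ n)
    (hD2 : ∀ p ∈ C, ∀ x, ∑ b ∈ bd p, dev x b ^ 2 ≤ D2 x)
    {x : X} (hx : x ∈ {x : X | ∃ p ∈ C, τ ≤ w p x}) :
    ((1 - θ) * τ) ^ 2 / n ≤ D2 x := by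
  obtain ⟨p, hp, hle⟩ := exists_sq_le_sum_sq_dev_of_largeField hLip hcentre hθτ hne hx
  have hcp : (0 : ℝ) < (bd p).card := by exact_mod_cast (hne p hp).card_pos
  have hcn : ((bd p).card : ℝ) ≤ n := by exact_mod_cast hcard p hp
  have hnum : 0 ≤ ((1 - θ) * τ) ^ 2 := sq_nonneg _
  calc ((1 - θ) * τ) ^ 2 / n ≤ ((1 - θ) * τ) ^ 2 / (bd p).card :=
        div_le_div_of_nonneg_left hnum hcp hcn
    _ ≤ ∑ b ∈ bd p, dev x b ^ 2 := hle
    _ ≤ D2 x := hD2 p hp x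

end Core

/-! ## §3 The floor letter `a = (λ∕2)·((1 − θ)τ)²∕n` -/

section Floor

variable {X P B : Type*} {C : Finset P} {bd : P → Finset B} {w : P → X → ℝ} {w₀ : P → ℝ} {dev : X → B → ℝ}
  {D2 I : X → ℝ} {θ τ m₀ lam : ℝ} {n : ℕ}

/-- THE FLOOR ON THE LARGE-FIELD EVENT: a displayed convexity floor `m₀ + (λ∕2)·D2 x ≤ I x` on a set `S` containing the large-field event,
with the separation of §2, gives `m₀ + (λ∕2)·((1 − θ)τ)²∕n ≤ I x` on the large-field event — the relative floor letter
`a = (λ∕2)·((1 − θ)τ)²∕n` from THREE numbers and one integer. [folklore] -/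
theorem floor_on_largeField {S : Set X} (hlam : 0 ≤ lam)
    (hLip : ∀ p ∈ C, ∀ x, |w p x - w₀ p| ≤ ∑ b ∈ bd p, dev x b)
    (hcentre : ∀ p ∈ C, w₀ p ≤ θ * τ) (hθτ : θ * τ ≤ τ) (hne : ∀ p ∈ C, (bd p).Nonempty)
    (hcard : ∀ p ∈ C, (bd p).card ≤ n)
    (hD2 : ∀ p ∈ C, ∀ x, ∑ b ∈ bd p, dev x b ^ 2 ≤ D2 x)
    (hS : {x : X | ∃ p ∈ C, τ ≤ w p x} ⊆ S) (hlow : ∀ x ∈ S, m₀ + lam / 2 * D2 x ≤ I x)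
    {x : X} (hx : x ∈ {x : X | ∃ p ∈ C, τ ≤ w p x}) :
    m₀ + lam / 2 * (((1 - θ) * τ) ^ 2 / n) ≤ I x := by
  have hsep : ((1 - θ) * τ) ^ 2 / n ≤ D2 x := sq_div_le_quadDev_of_largeField hLip hcentre hθτ hne hcard hD2 hx
  have hl : lam / 2 * (((1 - θ) * τ) ^ 2 / n) ≤ lam / 2 * D2 x := mul_le_mul_of_nonneg_left hsep (by positivity)
  linarith [hlow x (hS hx)]

/-- THE `hnum` DISPLAY, FIBREWISE (verbatim the hypothesis shape of `CompactFibreRelative.relFibre_moment_le`, with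
`m y := m₀ y + (λ∕2)·((1 − θ)τ)²∕n`): fibres `y` with weight `wgt y`, a numerator factor `F` supported in the large-field event of the core,
per-fibre centre values `w₀ y p` nested `θ`-deep inside `τ` wherever the weight is live, and a per-fibre convexity floor of modulus `λ` out to
the large-field event.  The relative large-field floor `a` is DISPLAYED — print's threshold nesting `θ` is its binder, NOT free. [folklore] -/
theorem hnum_of_nesting {Y : Type*} {F : X → ℝ} {wgt : Y → ℝ} {I : X × Y → ℝ} {m₀ : Y → ℝ} {w₀ : Y → P → ℝ}
    {dev : Y → X → B → ℝ} {D2 : Y → X → ℝ} (hlam : 0 ≤ lam)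
    (hLip : ∀ y, wgt y ≠ 0 → ∀ p ∈ C, ∀ x, |w p x - w₀ y p| ≤ ∑ b ∈ bd p, dev y x b)
    (hcentre : ∀ y, wgt y ≠ 0 → ∀ p ∈ C, w₀ y p ≤ θ * τ) (hθτ : θ * τ ≤ τ)
    (hne : ∀ p ∈ C, (bd p).Nonempty) (hcard : ∀ p ∈ C, (bd p).card ≤ n)
    (hD2 : ∀ y, ∀ p ∈ C, ∀ x, ∑ b ∈ bd p, dev y x b ^ 2 ≤ D2 y x)
    (hF : ∀ x, F x ≠ 0 → x ∈ {x : X | ∃ p ∈ C, τ ≤ w p x})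
    (hlow : ∀ y, wgt y ≠ 0 → ∀ x ∈ {x : X | ∃ p ∈ C, τ ≤ w p x}, m₀ y + lam / 2 * D2 y x ≤ I (x, y)) :
    ∀ x y, F x ≠ 0 → wgt y ≠ 0 → m₀ y + lam / 2 * (((1 - θ) * τ) ^ 2 / n) ≤ I (x, y) := by
  intro x y hFx hwy
  exact floor_on_largeField (S := {x : X | ∃ p ∈ C, τ ≤ w p x}) (I := fun x => I (x, y)) hlam (hLip y hwy) (hcentre y hwy)
    hθτ hne hcard (hD2 y) subset_rfl (hlow y hwy) (hF x hFx)

/-- By-value reading aid (pure arithmetic): for plaquettes (`n = 4`) the floor letter is `λ(1 − θ)²τ²∕8`. [folklore] -/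
theorem floor_letter_four (lam θ τ : ℝ) : lam / 2 * (((1 - θ) * τ) ^ 2 / (4 : ℕ)) = lam * (1 - θ) ^ 2 * τ ^ 2 / 8 := by
  push_cast
  ring

end Floor

/-! ## §4 Sanity: the letters are not vacuous (a two-bond toy) -/

/-- Toy instance on two bonds: observable `w = d₁ + d₂` (Lipschitz with constant one per bond about the centre value `0`), threshold `τ = 1`,
centre ratio `θ = 0`; a configuration with `w = 1` has `∑ d² ≥ 1∕2`, as `sq_div_card_le_sum_sq_dev_of_large` predicts. -/
example : ((1 - (0 : ℝ)) * 1) ^ 2 / (({0, 1} : Finset ℕ).card) ≤ ∑ b ∈ ({0, 1} : Finset ℕ), (fun _ : ℕ => (1 / 2 : ℝ)) b ^ 2 := by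
  refine sq_div_card_le_sum_sq_dev_of_large (w := 1) (w₀ := 0) (by simp) ?_ (by norm_num) (by norm_num) le_rfl
  simp


/-! ## §5 (v2, APPENDED after the landed bytes; §§1–4 above byte-identical) THE NESTING RATIO `θ` AT PRINT'S CREATION STEP, BY VALUE

The `θ`-binder of `hnum_of_nesting` at a CREATION step of [Balaban1989LargeFieldI] (= [B15]), from two printed displays read first-hand on the
page images `cmp_png/B15/p008.png` (p. 182), `p019`–`p023.png` (pp. 193–197), valued first by `b2b-balaban-t4-ne7b-formalise-leaf-02` g129
(KEY-READING R-leaf02-g129-3, pub-balaban journal l.56994): p. 182 (1.24), innermost shell «`|U^{(n)}_{k,Z}(∂p) − 1| < c(1 − β½)ε_j(L^{k−j}η)²`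
for `p ∈ Ω_{j−1}\Ω_{j+1}`», «`c = 1` for `j < k`, and `c = 3` for `j = k` … `0 < β ≦ 1∕2` … e.g., we can take `β = 1∕2` … `2 ≦ L₀ < 1∕2L`»
(outer shells `(1 − β½)L₀^{2m}ε_j(L^{k−j}η)²`); p. 195 (1.80) «`|U₀(∂p) − 1| < 2ε_kη² + O(1)B₃B₅M⁵exp(−δ dist(p, Λ))ε_kη²`» for `p ∈ Ω_k`
(`U₀ = U_{k,Z}(V_Λ)` (1.79), `V_Λ` the critical orbit of Proposition 1 with (1.78)), «From the estimate (1.80) we can see easily that the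
configuration `U₀` belongs to the integration domain determined by the characteristic function `χ″_k` in (1.76)».
WHICH COMPARISON, AND ITS USE IN PRINT: `θ_c` = the centre (1.80) against the scale-`k` shell of (1.24) at `c = 3` (= `χ″_k` of (1.76)); print
uses it to REMOVE `χ″_k` on the creation-step window («the functions `χ_{k,Λ}`, `χ′` should allow us to remove the function `χ″_k`», p. 196) —
§1∕§2's `obs_lt_of_nested` ∕ `window_subset_smallField` with `θτ := (2 + r)E` (`creation_nested_of_margin`).  The step's OWN new large-field
functions are `1 − χ_{k,Λ}` ((1.75), old boundary variables), `1 − χ′` ((1.82) «`χ′ = χ({|B′(b)| < δ′_k for b ∈ 𝔹₀})`»: the fresh bond variables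
— the window's own complement, separation `δ′_k` per bond, `θ`-FREE: §5b `hnum_of_window_complement`, floor `a = (λ∕2)δ′²`) and `χᶜ_{h,1∕2}`
((1.88): old-variable cubes at ratio `½` of (1.24)'s `c = 1` shells, by a decomposition of unity); the §3-type floor `floor_letter_creation_half`
is what a `χ″_k`-complement event WOULD carry, recorded for the renewal steps (1.25) whose events `1 − χ_k^{(n+1)}` ARE (1.24)-thresholds.
LETTERS (hypotheses, unvalued): `E := ε_kη²`, tail `r := O(1)B₃B₅M⁵e^{−δ·dist(p,Λ)}` (`K·e^{−δ·dd}` in `tail_lt_iff_log_lt`), `β`, `L₀`; threshold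
`τ = 3(1 − β∕2)E`, centre `w₀ ≤ (2 + r)E`, `θ_c := (2 + r)∕(3(1 − β∕2))` — `= 8∕9 + 4r∕9` at `β = ½` (`theta_creation_at_half`), `< 1 ↔ r < 1 − 3β∕2`
(`theta_creation_lt_one_iff`), i.e. a margin exactly where `δ·dist(p, Λ) > log(4K)` (`tail_lt_iff_log_lt`) — leaf-02's located caveat — which
print's GEOMETRY supplies: (1.73) p. 192 «`Λ = (Ω^{∼4}_{k₀+1})ᶜ ∩ Z` … obtained by adding one layer of `M`-cubes to `Z″_k`» and `Ω_k ⊂ Ω_{k₀+1}` put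
every `p ∈ Ω_k` at `≥ 4` `M`-cube layers from `Λ` (`tail_le_of_collar`), so `θ_c < 1` on all of `Ω_k` under ONE row `log(4K) < 4δ·Mc`
(`tail_lt_quarter_of_collar`; `Mc` = cube side in `dist`'s units, a letter); the `χ″_k`-half of GAPS G-B15-03 (p. 195's «easily», proof deferred,
not delivered in [I]–[V] per G-B16-12; analyticity half: `B15Membership195`) thus costs an `M`-largeness row, not a `p`-restriction; outer shells only
help (`three_le_L0_pow`, `centre_lt_outer_shell`); the lead value `2∕(3(1 − β∕2))` runs over `(2∕3, 8∕9]` as `0 < β ≤ ½`.  HONEST: a division of two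
printed displays; `O(1)`, `B₃`, `B₅`, `M`, `Mc`, `δ`, `ε_k`, `η`, the modulus `λ` and the minimiser are print's ∕ (A3)–(A1c)'s, NC-NE7b-α UNRULED;
nothing of Bałaban's asserted; NE7b NOT PRINTED ∕ NOT PROVED; spine 0∕9. -/

section Creation

variable {E β r w₀ : ℝ}

/-- The scale-`k` creation-step instance of §1's `hcentre`: a centre with `w₀ ≤ (2 + r)E` ((1.80)) is `θ_c`-deep inside the threshold
`τ = 3(1 − β∕2)E` ((1.24), `c = 3`), `θ_c = (2 + r)∕(3(1 − β∕2))` — for any `β < 2`. [folklore] -/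
theorem creation_centre_le_theta_mul (hβ : β < 2) (hw₀ : w₀ ≤ (2 + r) * E) :
    w₀ ≤ (2 + r) / (3 * (1 - β / 2)) * (3 * (1 - β / 2) * E) := by
  have hden : (3 * (1 - β / 2)) ≠ 0 := ne_of_gt (by linarith)
  have key : (2 + r) / (3 * (1 - β / 2)) * (3 * (1 - β / 2) * E) = (2 + r) * E := by rw [← mul_assoc, div_mul_cancel₀ _ hden]
  exact key ▸ hw₀

/-- `θ_c < 1 ↔ r < 1 − 3β∕2`: the centre is STRICTLY inside the scale-`k` threshold exactly when the boundary tail is below print's margin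
`3(1 − β∕2) − 2 = 1 − 3β∕2` (`= ¼` at `β = ½`, `→ 1` as `β → 0`). [folklore] -/
theorem theta_creation_lt_one_iff (hβ : β < 2) : (2 + r) / (3 * (1 - β / 2)) < 1 ↔ r < 1 - 3 * β / 2 := by
  have hpos : 0 < 3 * (1 - β / 2) := by linarith
  rw [div_lt_one hpos]
  constructor <;> intro h <;> linarith

/-- Print's choice `β = ½`: `θ_c = 8∕9 + 4r∕9`. [folklore] -/
theorem theta_creation_at_half (r : ℝ) : (2 + r) / (3 * (1 - (1 / 2 : ℝ) / 2)) = 8 / 9 + 4 * r / 9 := by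
  norm_num; ring

/-- The tail-free lead value at `β = ½` is `8∕9` EXACTLY (leaf-02 g129's number). [folklore] -/
theorem theta_lead_at_half : (2 : ℝ) / (3 * (1 - (1 / 2 : ℝ) / 2)) = 8 / 9 := by norm_num

/-- The separation numerator of §§1–3 at the creation step: `(1 − θ_c)·τ = (1 − 3β∕2 − r)·E` (any `β < 2`). [folklore] -/
theorem one_sub_theta_mul_threshold (hβ : β < 2) (r E : ℝ) :
    (1 - (2 + r) / (3 * (1 - β / 2))) * (3 * (1 - β / 2) * E) = (1 - 3 * β / 2 - r) * E := by
  have hden : (3 * (1 - β / 2)) ≠ 0 := ne_of_gt (by linarith)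
  have key : (2 + r) / (3 * (1 - β / 2)) * (3 * (1 - β / 2) * E) = (2 + r) * E := by rw [← mul_assoc, div_mul_cancel₀ _ hden]
  rw [sub_mul, key]; ring

/-- THE §3 FLOOR LETTER AT PRINT'S `β = ½`, per plaquette core (`n = 4`): `(λ∕2)((1 − θ_c)τ)²∕4 = λ(¼ − r)²E²∕8`. [folklore] -/
theorem floor_letter_creation_half (lam r E : ℝ) :
    lam / 2 * (((1 - (2 + r) / (3 * (1 - (1 / 2 : ℝ) / 2))) * (3 * (1 - (1 / 2 : ℝ) / 2) * E)) ^ 2 / (4 : ℕ)) =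
      lam * (1 / 4 - r) ^ 2 * E ^ 2 / 8 := by
  rw [one_sub_theta_mul_threshold (by norm_num) r E]; push_cast; ring

/-- WHERE IT IS UNIFORM: the tail `K·e^{−δ·dd}` is below a margin `c > 0` exactly when `δ·dd > log(K∕c)`; at `c = ¼` this is leaf-02's
«`dist(p, Λ) > δ⁻¹·log(4·O(1)B₃B₅M⁵)`». [folklore] -/
theorem tail_lt_iff_log_lt {K δ dd c : ℝ} (hK : 0 < K) (hc : 0 < c) :
    K * Real.exp (-(δ * dd)) < c ↔ Real.log (K / c) < δ * dd := by
  rw [← Real.exp_log hK, ← Real.exp_add, ← Real.exp_log hc, Real.exp_lt_exp, Real.exp_log hK, Real.exp_log hc,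
    Real.log_div hK.ne' hc.ne']
  constructor <;> intro h <;> linarith

/-- PRINT's GEOMETRY SUPPLIES THE DISTANCE ([B15] p. 192, (1.73) «`Λ = (Ω^{∼4}_{k₀+1})ᶜ ∩ Z`. This domain, obtained by adding one layer of
`M`-cubes to `Z″_k` …», with `Ω_k ⊂ Ω_{k₀+1}`): every `p ∈ Ω_k` — the domain on which (1.80) is asserted — lies `≥ 4` layers of `M`-cubes from
`Λ`; with `Mc` the cube side in the units of (1.80)'s `dist` (a letter), `dist(p, Λ) ≥ 4·Mc`, so the tail is at most `K·e^{−4δ·Mc}`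
UNIFORMLY on `Ω_k`. [folklore] -/
theorem tail_le_of_collar {K δ dd Mc : ℝ} (hK : 0 ≤ K) (hδ : 0 ≤ δ) (hdd : 4 * Mc ≤ dd) :
    K * Real.exp (-(δ * dd)) ≤ K * Real.exp (-(δ * (4 * Mc))) :=
  mul_le_mul_of_nonneg_left (Real.exp_le_exp.2 (by nlinarith)) hK

/-- Hence `θ_c < 1` on ALL of `Ω_k` under ONE largeness row on the cube side alone: `log(4K) < 4δ·Mc` (power of `M` inside `K = O(1)B₃B₅M⁵`
against an exponential in `Mc`) — leaf-02's `p`-dependent caveat becomes an `M`-row of the usual kind. [folklore] -/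
theorem tail_lt_quarter_of_collar {K δ dd Mc : ℝ} (hK : 0 < K) (hδ : 0 ≤ δ) (hM : Real.log (4 * K) < 4 * δ * Mc) (hdd : 4 * Mc ≤ dd) :
    K * Real.exp (-(δ * dd)) < 1 / 4 := by
  refine (tail_le_of_collar hK.le hδ hdd).trans_lt ((tail_lt_iff_log_lt hK (by norm_num)).2 ?_)
  rw [div_div_eq_mul_div, div_one, mul_comm K 4]
  linarith

/-- The outer shells of (1.24) only help: `L₀ ≥ 2 ⇒ L₀^{2m} ≥ 3` for `m ≥ 1`, so their coefficient `(1 − β∕2)L₀^{2m}` dominates the scale-`k`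
coefficient `3(1 − β∕2)` (for `β ≤ 2`). [folklore] -/
theorem three_le_L0_pow {L0 : ℝ} (hL0 : 2 ≤ L0) {m : ℕ} (hm : 1 ≤ m) : (3 : ℝ) ≤ L0 ^ (2 * m) := by
  have h4 : (4 : ℝ) ≤ L0 ^ 2 := by nlinarith
  have hm' := pow_le_pow_right₀ (by linarith : (1 : ℝ) ≤ L0 ^ 2) hm
  rw [pow_one, ← pow_mul] at hm'
  linarith

/-- Hence a centre inside the scale-`k` threshold is inside every outer shell's threshold `(1 − β∕2)L₀^{2m}E` as well. [folklore] -/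
theorem centre_lt_outer_shell {L0 : ℝ} (hL0 : 2 ≤ L0) {m : ℕ} (hm : 1 ≤ m) (hβ : β ≤ 2) (hE : 0 ≤ E)
    (hw₀ : w₀ < 3 * (1 - β / 2) * E) : w₀ < (1 - β / 2) * L0 ^ (2 * m) * E := by
  have := mul_le_mul_of_nonneg_left (three_le_L0_pow hL0 hm) (by linarith : 0 ≤ 1 - β / 2)
  nlinarith

/-- PRINT'S «EASILY» AS A MARGIN INEQUALITY (the creation-step instance of `obs_lt_of_nested`'s `hnest` with `θτ := (2 + r)E`): a window of
`#s` bonds of radius `ρ` about the centre stays STRICTLY inside the scale-`k` threshold as soon as `r·E + #s·ρ < (1 − 3β∕2)·E`. [folklore] -/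
theorem creation_nested_of_margin {B : Type*} {s : Finset B} {ρ : ℝ} (hm : r * E + s.card * ρ < (1 - 3 * β / 2) * E) :
    (2 + r) * E + s.card * ρ < 3 * (1 - β / 2) * E := by
  linarith

/-- Sanity (by value, print's `β = ½`, no tail): the centre at `2E` against the threshold `(9∕4)E` leaves the margin `E∕4`; four window
bonds of radius `ρ < E∕16` keep a plaquette word inside. -/
example {ρ : ℝ} (hρ : ρ < E / 16) :
    (2 + (0 : ℝ)) * E + (({0, 1, 2, 3} : Finset ℕ).card : ℝ) * ρ < 3 * (1 - (1 / 2 : ℝ) / 2) * E := by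
  refine creation_nested_of_margin ?_
  simp
  linarith

/-! ### §5b The creation step's own event `1 − χ′` ((1.82)): the window complement is `δ′`-separated, `θ`-free -/

variable {X B : Type*}

/-- One bond outside the window already carries `δ′²` of quadratic deviation: `(∃ b ∈ s, δ′ ≤ |dev b|) ⊢ δ′² ≤ ∑_{b ∈ s} (dev b)²`
(for `0 ≤ δ′`). [folklore] -/
theorem sq_le_sum_sq_of_exists_abs_ge {s : Finset B} {dev : B → ℝ} {δ' : ℝ} (hδ : 0 ≤ δ')
    (h : ∃ b ∈ s, δ' ≤ |dev b|) : δ' ^ 2 ≤ ∑ b ∈ s, dev b ^ 2 := by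
  obtain ⟨b, hb, hle⟩ := h
  exact ((pow_le_pow_left₀ hδ hle 2).trans_eq (sq_abs _)).trans (Finset.single_le_sum (fun b _ => sq_nonneg (dev b)) hb)

/-- THE `hnum` DISPLAY FOR THE WINDOW-COMPLEMENT EVENT (print's creation-step large-field function `1 − χ′`, (1.82): SOME fresh bond leaves
the window of radius `δ′` about the centre): with a displayed convexity floor `m₀ y + (λ∕2)·∑_b (dev y x b)² ≤ I (x, y)` on that event, the
relative floor is `a = (λ∕2)·δ′²` — NO nesting ratio enters (the shape of `CompactFibreRelative.relFibre_moment_le`'s `hnum`, verbatim).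
Print's instance: [Balaban1989LargeFieldII] p. 383, (1.77)–(1.78) ⟹ `Q > γ₀W⁻¹(A₁p₁)² − c` = the tree's `B16Sect1Kernels.form_lower_of_large_bond`
(`λ∕2 = ½γ₀W⁻¹`, `δ′ = A₁p₁(g_j)` in the rescaled bond variable); WHICH `λ`, and that the floor reaches the event, are (A3)∕(A1c). [folklore] -/
theorem hnum_of_window_complement {Y : Type*} {s : Finset B} {F : X → ℝ} {wgt : Y → ℝ} {I : X × Y → ℝ} {m₀ : Y → ℝ}
    {dev : Y → X → B → ℝ} {lam δ' : ℝ} (hlam : 0 ≤ lam) (hδ : 0 ≤ δ')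
    (hF : ∀ x y, F x ≠ 0 → wgt y ≠ 0 → ∃ b ∈ s, δ' ≤ |dev y x b|)
    (hlow : ∀ x y, F x ≠ 0 → wgt y ≠ 0 → m₀ y + lam / 2 * ∑ b ∈ s, dev y x b ^ 2 ≤ I (x, y)) :
    ∀ x y, F x ≠ 0 → wgt y ≠ 0 → m₀ y + lam / 2 * δ' ^ 2 ≤ I (x, y) := by
  intro x y hFx hwy
  have hsq : δ' ^ 2 ≤ ∑ b ∈ s, dev y x b ^ 2 := sq_le_sum_sq_of_exists_abs_ge hδ (hF x y hFx hwy)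
  have := mul_le_mul_of_nonneg_left hsq (by positivity : 0 ≤ lam / 2)
  linarith [hlow x y hFx hwy]

end Creation

end Summit.QuantumFields.BalabanUV.T4Continuum.NE7b.NestedWindows
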